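import Summits.HubbardSuperconductivity.HubbardSuperconductivity.Theorems.TwTipContinuation.Negative.TipNormalForm

/-!
# `TwTipContinuation` (stmt-HubbardSuperconductivity-1700) — line `isogap-submodular-transport`, lead skeleton

Crux (route `ThermalWedge`, rank 6): `Summit.HubbardSuperconductivity.HubbardSuperconductivity.Theses.ThermalWedge.TwTipContinuation`.
By `twTipContinuation_of_uniformSummit` + `summitMatrix_of_everyGSOrder` (Theorems/TwTipContinuation/Negative/TipNormalForm.lean)
it suffices to produce, at ONE `δ ∈ [1/10,2/5]` and for ALL `U ∈ (0,U₁]`, an eventual uniform EVERY-ground-state bound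
`c L⁴ ≤ re⟨ψ, P_L ψ⟩` for the PURE torus `hubbardTorus 2 L 1 U` in the sector `(2⌊(1-δ)L²/2⌋, S^z = 0)`
(`P_L = (pairField d L)ᴴ (pairField d L)`); the RUNG antecedent of the crux is discarded (Disproof §1/§5).

Line (card `Cruxes/TwTipContinuation/Ideas/isogap-submodular-transport.md`, reshaped by the crux planner into STRIP + Danskin +
homogeneity; skeleton fc3a0f08): with `E_L(U,g) := minEnergyOn (hubbardTorus 2 L 1 U − (g/L²)P_L) (szSector (2n) 0)`, `n = ⌊(1-δ)L²/2⌋`,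
* `stub_edgeOrder`      — every GS of the U = 0 reduced d-wave BCS torus `hubbardTorus 2 L 1 0 − (c/L²)P_L` has `re⟨P_L⟩ ≥ μ(c,δ) L⁴`;
* `stub_isogapTransport` — STRIP transport along isogap characteristics (the crux-sized stub, held by the lead): at one δ, for all small U,
  `E_L(U,0) − E_L(U,s) ≥ E_L(0,aU²) − E_L(0,aU²+s) − ε s L²` for all seeds `s ∈ (0,s₁]`, eventually in even `L`;
* `stub_danskinAttainment` — finite-dimensional Danskin: a linear lower bound `B·s ≤ E_L(U,0) − E_L(U,s)` (`0 < s < s₁`) is attained by the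
  pair intensity of SOME normalised sector ground state of the pure torus, `B L² ≤ re⟨ψ₀,P_Lψ₀⟩`;
* `stub_groundSpaceHomogeneity` — the every-GS layer: eventually in even `L` all normalised sector ground states of the pure torus have the
  same pair-intensity density up to `ε L⁴`.
Composition `TwTipContinuation_of`: edge order `μ` at seed `aU²` ⇒ (right chord, `order_le_rightChord`) free gain `≥ μ s L²` ⇒ (transport,
`ε = μ/4`) pure gain `≥ (3μ/4) s L²` ⇒ (Danskin) a GS with `re⟨P_L⟩ ≥ (3μ/4)L⁴` ⇒ (homogeneity, `ε = μ/4`) EVERY GS `≥ (μ/2)L⁴`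
⇒ `summitMatrix_of_everyGSOrder` ⇒ `twTipContinuation_of_uniformSummit`.

All statements are on the LITERAL route terms (no local abbreviations), so that each stub can land verbatim as a `--supports` helper.
-/

noncomputable section

namespace Summit.HubbardSuperconductivity.TwTipContinuation.IsogapTransport

open Matrix Filter Finset
open Literature.MathematicalPhysics.QuantumLattice Literature.Probability.LatticeModels
open Summit.HubbardSuperconductivity.HubbardSuperconductivity.Theses.ThermalWedge
open Summit.HubbardSuperconductivity.TwTipContinuation.Negative
open scoped ComplexOrder

/-! ### The four stubs (registered on stmt-HubbardSuperconductivity-1700) -/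

/-- STUB (L/XL, classical): **every ground state of the U = 0 reduced d-wave BCS torus is ordered.** For every doping of the window and
every seed `c > 0` there is `μ > 0` such that, eventually in even `L`, every normalised ground state of
`hubbardTorus 2 L 1 0 − (c/L²)P_L` in the sector `(2⌊(1-δ)L²/2⌋, S^z=0)` has `μ L⁴ ≤ re⟨ψ,P_Lψ⟩`. Route inside the stub (no hard half of
the approximating-Hamiltonian theorem needed): left chord at `c' = 0` (`leftChord_le_order`), where the sector energy is the free Fermi
sea, plus a BCS trial energy `≤ E_FS(N_L) − κ L²` obtained from the grand-canonical BCS product state by sector decomposition and the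
`O(1)` pair-addition cost. Bardeen–Cooper–Schrieffer 1957; Bogoliubov 1958; Leggett, Quantum Liquids (2006) §5.4. [folklore] -/
theorem stub_edgeOrder :
    ∀ δ ∈ Set.Icc (1 / 10 : ℝ) (2 / 5), ∀ c : ℝ, 0 < c → ∃ μ : ℝ, 0 < μ ∧ ∃ L₀ : ℕ, ∀ (L : ℕ) [NeZero L], L₀ ≤ L → Even L →
      ∀ ψ : Fock (Orb (FermionTorus 2 L)), star ψ ⬝ᵥ ψ = 1 →
        IsGroundStateInSector (hubbardTorus 2 L 1 0 - ((c / (L : ℝ) ^ 2 : ℝ) : ℂ) • ((pairField dWaveFormFactor L)ᴴ * pairField dWaveFormFactor L)) (2 * ⌊(1 - δ) * (L : ℝ) ^ 2 / 2⌋₊) 0 ψ →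
          μ * (L : ℝ) ^ 4 ≤ (expect ((pairField dWaveFormFactor L)ᴴ * pairField dWaveFormFactor L) ψ).re := by
  sorry

/-- STUB (XL, crux-sized — held by the line lead): **STRIP transport along isogap characteristics.** At one doping of the window there
are `U₁, a > 0` such that for every `U ∈ (0,U₁]` and some `s₁ > 0`: for every `ε > 0`, eventually in even `L`, for all seeds
`s ∈ (0,s₁]`, the pure torus gains at least as much energy from the seed `s` as the U = 0 reduced-BCS edge gains between the seeds
`aU²` and `aU² + s`, up to `ε s L²`. (Kohn–Luttinger sign with an `O(1)` relative margin `a < a₂(δ)`; by Danskin it is the any-GS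
d-wave order floor `m²(U, pure) ≥ m²_BCS(aU²)`.) Kohn–Luttinger 1965; Raghu–Kivelson–Scalapino 2010 §III. [folklore] -/
theorem stub_isogapTransport :
    ∃ δ ∈ Set.Icc (1 / 10 : ℝ) (2 / 5), ∃ U₁ a : ℝ, 0 < U₁ ∧ 0 < a ∧ ∀ U ∈ Set.Ioc (0 : ℝ) U₁, ∃ s₁ : ℝ, 0 < s₁ ∧
      ∀ ε : ℝ, 0 < ε → ∃ L₀ : ℕ, ∀ (L : ℕ) [NeZero L], L₀ ≤ L → Even L → ∀ s ∈ Set.Ioc (0 : ℝ) s₁,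
        (Matrix.minEnergyOn (hubbardTorus 2 L 1 0 - ((a * U ^ 2 / (L : ℝ) ^ 2 : ℝ) : ℂ) • ((pairField dWaveFormFactor L)ᴴ * pairField dWaveFormFactor L)) (szSector (2 * ⌊(1 - δ) * (L : ℝ) ^ 2 / 2⌋₊) 0))
          - (Matrix.minEnergyOn (hubbardTorus 2 L 1 0 - (((a * U ^ 2 + s) / (L : ℝ) ^ 2 : ℝ) : ℂ) • ((pairField dWaveFormFactor L)ᴴ * pairField dWaveFormFactor L)) (szSector (2 * ⌊(1 - δ) * (L : ℝ) ^ 2 / 2⌋₊) 0))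
          - ε * s * (L : ℝ) ^ 2 ≤
        (Matrix.minEnergyOn (hubbardTorus 2 L 1 U) (szSector (2 * ⌊(1 - δ) * (L : ℝ) ^ 2 / 2⌋₊) 0))
          - (Matrix.minEnergyOn (hubbardTorus 2 L 1 U - ((s / (L : ℝ) ^ 2 : ℝ) : ℂ) • ((pairField dWaveFormFactor L)ᴴ * pairField dWaveFormFactor L)) (szSector (2 * ⌊(1 - δ) * (L : ℝ) ^ 2 / 2⌋₊) 0)) := by
  sorry

/-- STUB (L, the every-GS layer): **ground-space homogeneity of the pair intensity of the pure torus.** For every doping of the window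
there is `U₁ > 0` such that for all `U ∈ (0,U₁]` and `ε > 0`, eventually in even `L`, any two normalised sector ground states of
`hubbardTorus 2 L 1 U` have pair intensities within `ε L⁴`. (What Schur gives when the ground multiplet is one irreducible symmetry
multiplet; the bet is the absence of accidental intruders for every small `U`.) Tasaki 2020 §2.2. [folklore] -/
theorem stub_groundSpaceHomogeneity :
    ∀ δ ∈ Set.Icc (1 / 10 : ℝ) (2 / 5), ∃ U₁ : ℝ, 0 < U₁ ∧ ∀ U ∈ Set.Ioc (0 : ℝ) U₁, ∀ ε : ℝ, 0 < ε → ∃ L₀ : ℕ, ∀ (L : ℕ) [NeZero L], L₀ ≤ L → Even L →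
      ∀ ψ ψ' : Fock (Orb (FermionTorus 2 L)), star ψ ⬝ᵥ ψ = 1 → star ψ' ⬝ᵥ ψ' = 1 →
        IsGroundStateInSector (hubbardTorus 2 L 1 U) (2 * ⌊(1 - δ) * (L : ℝ) ^ 2 / 2⌋₊) 0 ψ →
        IsGroundStateInSector (hubbardTorus 2 L 1 U) (2 * ⌊(1 - δ) * (L : ℝ) ^ 2 / 2⌋₊) 0 ψ' →
          (expect ((pairField dWaveFormFactor L)ᴴ * pairField dWaveFormFactor L) ψ).re ≤
            (expect ((pairField dWaveFormFactor L)ᴴ * pairField dWaveFormFactor L) ψ').re + ε * (L : ℝ) ^ 4 := by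
  sorry

/-- STUB (M, finite-dimensional Danskin): **a linear lower bound on the seed's energy gain is attained by a ground state's pair
intensity.** If `B·s ≤ E_L(U,0) − E_L(U,s)` for all `0 < s < s₁` (sector `(2n,0)`, `n ≤ L²`), then some normalised sector ground state
`ψ₀` of the pure torus has `B L² ≤ re⟨ψ₀,P_Lψ₀⟩` (the right derivative of the concave `s ↦ E_L(U,s)` at `0` is `−L⁻² max_GS re⟨P_L⟩`,
first-order perturbation theory on the ground eigenspace). Danskin 1966; Kato 1966 II §6. [folklore] -/
theorem stub_danskinAttainment :
    ∀ (L : ℕ) [NeZero L] (U : ℝ) (n : ℕ) (B s₁ : ℝ), n ≤ Fintype.card (FermionTorus 2 L) → 0 < s₁ →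
      (∀ s ∈ Set.Ioo (0 : ℝ) s₁, B * s ≤
        (Matrix.minEnergyOn (hubbardTorus 2 L 1 U) (szSector (2 * n) 0))
          - (Matrix.minEnergyOn (hubbardTorus 2 L 1 U - ((s / (L : ℝ) ^ 2 : ℝ) : ℂ) • ((pairField dWaveFormFactor L)ᴴ * pairField dWaveFormFactor L)) (szSector (2 * n) 0))) →
      ∃ ψ : Fock (Orb (FermionTorus 2 L)), star ψ ⬝ᵥ ψ = 1 ∧ IsGroundStateInSector (hubbardTorus 2 L 1 U) (2 * n) 0 ψ ∧
        B * (L : ℝ) ^ 2 ≤ (expect ((pairField dWaveFormFactor L)ᴴ * pairField dWaveFormFactor L) ψ).re := by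
  sorry

/-! ### Composition (sorry-free modulo the four stubs) -/

/-- Step A of the composition: every-GS order `μ L⁴` of the seeded torus at seed `g` gives a LINEAR energy gain `μ s L²` from any further
seed `s > 0` (right chord at a normalised ground state, which exists in the sector `(2n,0)`, `n ≤ L²`). [folklore] -/
theorem isogap_linearGain_of_order {U g μ : ℝ} {L : ℕ} [NeZero L] {n : ℕ} (hn : n ≤ Fintype.card (FermionTorus 2 L))
    (h : ∀ ψ : Fock (Orb (FermionTorus 2 L)), star ψ ⬝ᵥ ψ = 1 →
      IsGroundStateInSector (hubbardTorus 2 L 1 U - ((g / (L : ℝ) ^ 2 : ℝ) : ℂ) • ((pairField dWaveFormFactor L)ᴴ * pairField dWaveFormFactor L)) (2 * n) 0 ψ →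
        μ * (L : ℝ) ^ 4 ≤ (expect ((pairField dWaveFormFactor L)ᴴ * pairField dWaveFormFactor L) ψ).re)
    {s : ℝ} (hs : 0 < s) :
    μ * s * (L : ℝ) ^ 2 ≤
      (Matrix.minEnergyOn (hubbardTorus 2 L 1 U - ((g / (L : ℝ) ^ 2 : ℝ) : ℂ) • ((pairField dWaveFormFactor L)ᴴ * pairField dWaveFormFactor L)) (szSector (2 * n) 0))
        - (Matrix.minEnergyOn (hubbardTorus 2 L 1 U - (((g + s) / (L : ℝ) ^ 2 : ℝ) : ℂ) • ((pairField dWaveFormFactor L)ᴴ * pairField dWaveFormFactor L)) (szSector (2 * n) 0)) := by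
  obtain ⟨ψ, hψ, hgs⟩ := exists_unit_groundState U g L hn
  have hr := order_le_rightChord (U := U) (g := g) (g'' := g + s) (by linarith) hψ hgs
  have hb := h ψ hψ hgs
  have hL : (0 : ℝ) < (L : ℝ) ^ 2 := by
    have := NeZero.pos L
    positivity
  have key : (g + s - g) / (L : ℝ) ^ 2 * (μ * (L : ℝ) ^ 4) ≤
      (g + s - g) / (L : ℝ) ^ 2 * (expect ((pairField dWaveFormFactor L)ᴴ * pairField dWaveFormFactor L) ψ).re :=
    mul_le_mul_of_nonneg_left hb (div_nonneg (by linarith) hL.le)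
  have hid : (g + s - g) / (L : ℝ) ^ 2 * (μ * (L : ℝ) ^ 4) = μ * s * (L : ℝ) ^ 2 := by
    field_simp
    ring
  linarith

/-- **The line's composition**: the four stubs give `TwTipContinuation` (entry through `twTipContinuation_of_uniformSummit`, the RUNG
antecedent unused). [folklore] -/
theorem TwTipContinuation_of : TwTipContinuation := by
  obtain ⟨δ, hδ, U₁, a, hU₁, ha, hT⟩ := stub_isogapTransport
  obtain ⟨U₂, hU₂, hH⟩ := stub_groundSpaceHomogeneity δ hδ
  refine twTipContinuation_of_uniformSummit ⟨min U₁ U₂, lt_min hU₁ hU₂, δ, hδ, fun U hU => ?_⟩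
  apply summitMatrix_of_everyGSOrder
  have hU1 : U ∈ Set.Ioc (0 : ℝ) U₁ := ⟨hU.1, hU.2.trans (min_le_left _ _)⟩
  have hU2 : U ∈ Set.Ioc (0 : ℝ) U₂ := ⟨hU.1, hU.2.trans (min_le_right _ _)⟩
  have hδ' : (-1 : ℝ) ≤ δ := by linarith [hδ.1]
  have haU : 0 < a * U ^ 2 := by
    have := hU.1
    positivity
  obtain ⟨μ, hμ, L₁, hE⟩ := stub_edgeOrder δ hδ (a * U ^ 2) haU
  obtain ⟨s₁, hs₁, hT'⟩ := hT U hU1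
  obtain ⟨L₂, hT''⟩ := hT' (μ / 4) (by positivity)
  obtain ⟨L₃, hH'⟩ := hH U hU2 (μ / 4) (by positivity)
  refine ⟨μ / 2, by positivity, max L₁ (max L₂ L₃), fun L _ hL hEv ψ hψ hgs => ?_⟩
  have hL₁ : L₁ ≤ L := le_trans (le_max_left _ _) hL
  have hL₂ : L₂ ≤ L := le_trans ((le_max_left _ _).trans (le_max_right _ _)) hL
  have hL₃ : L₃ ≤ L := le_trans ((le_max_right _ _).trans (le_max_right _ _)) hL
  have hn : ⌊(1 - δ) * (L : ℝ) ^ 2 / 2⌋₊ ≤ Fintype.card (FermionTorus 2 L) := by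
    rw [Summit.HubbardSuperconductivity.NoGo.card_fermionTorus_two]
    exact Summit.HubbardSuperconductivity.NoGo.floor_pairNumber_le δ hδ' L
  -- Step A + B: the pure torus gains at least `(3μ/4) s L²` from every seed `s ∈ (0, s₁]`
  have hgain : ∀ s ∈ Set.Ioo (0 : ℝ) s₁, (3 * μ / 4 * (L : ℝ) ^ 2) * s ≤
      (Matrix.minEnergyOn (hubbardTorus 2 L 1 U) (szSector (2 * ⌊(1 - δ) * (L : ℝ) ^ 2 / 2⌋₊) 0))
        - (Matrix.minEnergyOn (hubbardTorus 2 L 1 U - ((s / (L : ℝ) ^ 2 : ℝ) : ℂ) • ((pairField dWaveFormFactor L)ᴴ * pairField dWaveFormFactor L)) (szSector (2 * ⌊(1 - δ) * (L : ℝ) ^ 2 / 2⌋₊) 0)) := by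
    intro s hs
    have hA := isogap_linearGain_of_order (U := 0) (g := a * U ^ 2) (μ := μ) hn (hE L hL₁ hEv) hs.1
    have hB := hT'' L hL₂ hEv s ⟨hs.1, hs.2.le⟩
    have : (3 * μ / 4 * (L : ℝ) ^ 2) * s = μ * s * (L : ℝ) ^ 2 - μ / 4 * s * (L : ℝ) ^ 2 := by ring
    linarith
  -- Step C: Danskin attainment — some ground state of the pure torus carries `(3μ/4) L⁴`
  obtain ⟨ψ₀, hψ₀, hgs₀, hP₀⟩ := stub_danskinAttainment L U _ (3 * μ / 4 * (L : ℝ) ^ 2) s₁ hn hs₁ hgain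
  -- Step D: homogeneity — every ground state carries `(μ/2) L⁴`
  have hhom := hH' L hL₃ hEv ψ₀ ψ hψ₀ hψ hgs₀ hgs
  have : 3 * μ / 4 * (L : ℝ) ^ 2 * (L : ℝ) ^ 2 = 3 * μ / 4 * (L : ℝ) ^ 4 := by ring
  nlinarith [hP₀, hhom, this]

end Summit.HubbardSuperconductivity.TwTipContinuation.IsogapTransport
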